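import Literature.NumberTheory.LFunctions.WeilTwoPrimeOddMarginKBase
import Literature.NumberTheory.LFunctions.WeilBlockRows
import HarnessLib

/-!
# Two-prime odd-margin certificate K: rows 54–71 of the check `D C = I` (odd block)

Part of the odd-block check of `weilCert23K` (`WeilCert.checkDCRow`), `decide +kernel` row by row. Pure proof file; nothing is asserted.
-/

noncomputable section

namespace Literature.NumberTheory.LFunctions

set_option maxHeartbeats 0 in
/-- Kernel check of row 54 of `D C = I` (certificate K). [folklore] -/
theorem checkDCRow1_54_weilCert23K : weilCert23KBase.checkDCRow 1 54 = true := by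
  decide +kernel

set_option maxHeartbeats 0 in
/-- Kernel check of row 55 of `D C = I` (certificate K). [folklore] -/
theorem checkDCRow1_55_weilCert23K : weilCert23KBase.checkDCRow 1 55 = true := by
  decide +kernel

set_option maxHeartbeats 0 in
/-- Kernel check of row 56 of `D C = I` (certificate K). [folklore] -/
theorem checkDCRow1_56_weilCert23K : weilCert23KBase.checkDCRow 1 56 = true := by
  decide +kernel

set_option maxHeartbeats 0 in
/-- Kernel check of row 57 of `D C = I` (certificate K). [folklore] -/
theorem checkDCRow1_57_weilCert23K : weilCert23KBase.checkDCRow 1 57 = true := by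
  decide +kernel

set_option maxHeartbeats 0 in
/-- Kernel check of row 58 of `D C = I` (certificate K). [folklore] -/
theorem checkDCRow1_58_weilCert23K : weilCert23KBase.checkDCRow 1 58 = true := by
  decide +kernel

set_option maxHeartbeats 0 in
/-- Kernel check of row 59 of `D C = I` (certificate K). [folklore] -/
theorem checkDCRow1_59_weilCert23K : weilCert23KBase.checkDCRow 1 59 = true := by
  decide +kernel

set_option maxHeartbeats 0 in
/-- Kernel check of row 60 of `D C = I` (certificate K). [folklore] -/
theorem checkDCRow1_60_weilCert23K : weilCert23KBase.checkDCRow 1 60 = true := by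
  decide +kernel

set_option maxHeartbeats 0 in
/-- Kernel check of row 61 of `D C = I` (certificate K). [folklore] -/
theorem checkDCRow1_61_weilCert23K : weilCert23KBase.checkDCRow 1 61 = true := by
  decide +kernel

set_option maxHeartbeats 0 in
/-- Kernel check of row 62 of `D C = I` (certificate K). [folklore] -/
theorem checkDCRow1_62_weilCert23K : weilCert23KBase.checkDCRow 1 62 = true := by
  decide +kernel

set_option maxHeartbeats 0 in
/-- Kernel check of row 63 of `D C = I` (certificate K). [folklore] -/
theorem checkDCRow1_63_weilCert23K : weilCert23KBase.checkDCRow 1 63 = true := by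
  decide +kernel

set_option maxHeartbeats 0 in
/-- Kernel check of row 64 of `D C = I` (certificate K). [folklore] -/
theorem checkDCRow1_64_weilCert23K : weilCert23KBase.checkDCRow 1 64 = true := by
  decide +kernel

set_option maxHeartbeats 0 in
/-- Kernel check of row 65 of `D C = I` (certificate K). [folklore] -/
theorem checkDCRow1_65_weilCert23K : weilCert23KBase.checkDCRow 1 65 = true := by
  decide +kernel

set_option maxHeartbeats 0 in
/-- Kernel check of row 66 of `D C = I` (certificate K). [folklore] -/
theorem checkDCRow1_66_weilCert23K : weilCert23KBase.checkDCRow 1 66 = true := by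
  decide +kernel

set_option maxHeartbeats 0 in
/-- Kernel check of row 67 of `D C = I` (certificate K). [folklore] -/
theorem checkDCRow1_67_weilCert23K : weilCert23KBase.checkDCRow 1 67 = true := by
  decide +kernel

set_option maxHeartbeats 0 in
/-- Kernel check of row 68 of `D C = I` (certificate K). [folklore] -/
theorem checkDCRow1_68_weilCert23K : weilCert23KBase.checkDCRow 1 68 = true := by
  decide +kernel

set_option maxHeartbeats 0 in
/-- Kernel check of row 69 of `D C = I` (certificate K). [folklore] -/
theorem checkDCRow1_69_weilCert23K : weilCert23KBase.checkDCRow 1 69 = true := by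
  decide +kernel

set_option maxHeartbeats 0 in
/-- Kernel check of row 70 of `D C = I` (certificate K). [folklore] -/
theorem checkDCRow1_70_weilCert23K : weilCert23KBase.checkDCRow 1 70 = true := by
  decide +kernel

set_option maxHeartbeats 0 in
/-- Kernel check of row 71 of `D C = I` (certificate K). [folklore] -/
theorem checkDCRow1_71_weilCert23K : weilCert23KBase.checkDCRow 1 71 = true := by
  decide +kernel


end Literature.NumberTheory.LFunctions
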